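import Literature.NumberTheory.EllipticCurves.FormalGroupLawAxiomsProofs
import HarnessLib

/-!
# Associativity of the formal group law for every `p`-integral Weierstrass equation over `ℚ_p`
# (no `IsElliptic` hypothesis; proofs only)

Trunk T-NT-EC (Literature/NumberTheory/EllipticCurves). `FormalGroupLawAxiomsProofs.lean` proves
the formal-group axioms of the chord–tangent law `F = formalGroupLaw W` (Silverman AEC IV.1–2) for
ELLIPTIC curves with `p`-integral equation, the hypothesis `[W.IsElliptic]` entering only through
the inverse dictionary `exists_isInReductionKernel_formalParameter_eq` (every `z ∈ pℤ_p` is `z(P)`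
for some `P ∈ E₁(ℚ_p)`), where nonsingularity of the affine point `(z/w(z), -1/w(z))` was taken
from `equation_iff_nonsingular`. The named fact `WeierstrassCurve.padicLogPoint_add` (AEC VII.2.2
+ IV.6.4(a)) is stated for every MINIMAL equation — in Mathlib's sense this includes integral
equations with `Δ = 0` — so we remove the hypothesis:

* `nonsingular_of_one_lt_norm_x` — on a `p`-integral equation every solution `(x, y)` with
  `‖x‖_p > 1` is a nonsingular point (from `‖y‖² = ‖x‖³`: for `p ≠ 3` the term `3x²` dominates
  `∂F/∂x = a₁y - 3x² - 2a₂x - a₄`, for `p = 3` the term `2y` dominates `∂F/∂y = 2y + a₁x + a₃`);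
  so points of `E₁(ℚ_p)` are nonsingular even on a singular cubic (they reduce to `Õ`, a smooth
  point of the reduction).
* `exists_isInReductionKernel_formalParameter_eq_of_isIntegral` — the inverse dictionary
  `pℤ_p → E₁(ℚ_p)`, `z ↦ (z/w(z), -1/w(z))` (AEC VII.2.2), for every integral equation;
* `padicEval₂_formalGroupLaw_eq_formalParameter_add` — `F(z(P), z(Q)) = z(P + Q)` on `E₁(ℚ_p)`
  (AEC VII.2.2; the case analysis of `formalGroupLaw_padicEval_holds`, whose four case lemmas in
  `FormalGroupLawPadicProofs.lean` never used `IsElliptic`);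
* `padicEval₂_formalGroupLaw_assoc_of_isIntegral`, `formalGroupLaw_assoc_of_isIntegral` —
  **`F(F(z₁,z₂),z₃) = F(z₁,F(z₂,z₃))` in `ℚ_p⟦z₁,z₂,z₃⟧`** for every `p`-integral `W/ℚ_p`
  (AEC IV.2: associativity "from the corresponding properties of the addition law on `E`", by the
  identity theorem for integral power series, as in `formalGroupLaw_assoc`).

## Sources

* J. H. Silverman, *The Arithmetic of Elliptic Curves*, 2nd ed. (2009): IV.1–IV.2, VII.2.2
  (`SilvermanAEC2009`).
-/

noncomputable section

open scoped Classical
open PowerSeries Literature.NumberTheory.EllipticCurves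

namespace WeierstrassCurve

variable {p : ℕ} [Fact p.Prime] (W : WeierstrassCurve ℚ_[p]) [hW : W.IsIntegral ℤ_[p]]

/-! ### Points of `E₁(ℚ_p)` are nonsingular -/

/-- **Solutions with `‖x‖_p > 1` of a `p`-integral Weierstrass equation are nonsingular points.**
With `‖y‖² = ‖x‖³` (`norm_sq_eq_norm_cube`): if `p ≠ 3` then `‖3x²‖ = ‖x‖²` strictly exceeds
`‖a₁y‖, ‖2a₂x‖, ‖a₄‖`, so `a₁y - 3x² - 2a₂x - a₄ ≠ 0`; if `p = 3` then `‖2y‖ = ‖y‖` strictly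
exceeds `‖a₁x‖, ‖a₃‖`, so `2y + a₁x + a₃ ≠ 0`. [Silverman AEC VII.2.2 (points of `E₁(K)`
reduce to the smooth point `Õ`)] [folklore] -/
theorem nonsingular_of_one_lt_norm_x {x y : ℚ_[p]} (heq : W.toAffine.Equation x y) (hx : 1 < ‖x‖) :
    W.toAffine.Nonsingular x y := by
  obtain ⟨h₁, h₂, h₃, h₄, -⟩ := W.norm_coeffs_le_one
  obtain ⟨hsq, hxy⟩ := W.norm_sq_eq_norm_cube heq hx
  have hx0 : 0 < ‖x‖ := one_pos.trans hx
  have hy0 : 0 < ‖y‖ := hx0.trans hxy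
  -- `‖y‖ < ‖x‖²` from `‖y‖² = ‖x‖³ < ‖x‖⁴`
  have hyx2 : ‖y‖ < ‖x‖ ^ 2 := by
    have h : ‖y‖ ^ 2 < (‖x‖ ^ 2) ^ 2 := by
      rw [hsq, ← pow_mul]
      exact pow_lt_pow_right₀ hx (by norm_num)
    exact (pow_lt_pow_iff_left₀ (norm_nonneg _) (by positivity) two_ne_zero).mp h
  have hnat : ∀ n : ℕ, ‖(n : ℚ_[p])‖ ≤ 1 ∧ (p.Coprime n → ‖(n : ℚ_[p])‖ = 1) := fun n => by
    rw [← PadicInt.coe_natCast, PadicInt.padic_norm_e_of_padicInt]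
    exact ⟨PadicInt.norm_le_one _, fun hn => PadicInt.norm_natCast_eq_one_iff.mpr hn⟩
  rw [Affine.nonsingular_iff']
  refine ⟨heq, ?_⟩
  by_cases hp3 : p = 3
  · -- `p = 3`: the term `2y` dominates `∂F/∂y`
    right
    have h2 : ‖(2 : ℚ_[p])‖ = 1 := by
      have := (hnat 2).2 ((Nat.coprime_primes Fact.out Nat.prime_two).mpr (by omega))
      exact_mod_cast this
    have hlt : ‖W.a₁ * x + W.a₃‖ < ‖y‖ :=
      (Padic.nonarchimedean _ _).trans_lt (max_lt
        (by rw [norm_mul]; exact (mul_le_of_le_one_left (norm_nonneg _) h₁).trans_lt hxy)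
        (h₃.trans_lt (hx.trans hxy)))
    intro h0
    have hy2 : y = -(W.a₁ * x + W.a₃) * (2 : ℚ_[p])⁻¹ := by
      field_simp
      linear_combination h0
    have : ‖y‖ = ‖W.a₁ * x + W.a₃‖ := by
      rw [hy2, norm_mul, norm_neg, norm_inv, h2, inv_one, mul_one]
    rw [this] at hlt
    exact lt_irrefl _ hlt
  · -- `p ≠ 3`: the term `3x²` dominates `∂F/∂x`
    left
    have h3 : ‖(3 : ℚ_[p])‖ = 1 := by
      have := (hnat 3).2 ((Nat.coprime_primes Fact.out Nat.prime_three).mpr hp3)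
      exact_mod_cast this
    have h2le : ‖(2 : ℚ_[p])‖ ≤ 1 := by exact_mod_cast (hnat 2).1
    have hx2 : ‖x‖ < ‖x‖ ^ 2 := by nlinarith
    have hlt : ‖W.a₁ * y - 2 * W.a₂ * x - W.a₄‖ < ‖x‖ ^ 2 := by
      rw [sub_eq_add_neg, sub_eq_add_neg]
      refine (Padic.nonarchimedean _ _).trans_lt (max_lt ((Padic.nonarchimedean _ _).trans_lt (max_lt ?_ ?_)) ?_)
      · rw [norm_mul]; exact (mul_le_of_le_one_left (norm_nonneg _) h₁).trans_lt hyx2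
      · rw [norm_neg, norm_mul, norm_mul]
        calc ‖(2 : ℚ_[p])‖ * ‖W.a₂‖ * ‖x‖ ≤ 1 * 1 * ‖x‖ := by gcongr
          _ = ‖x‖ := by ring
          _ < ‖x‖ ^ 2 := hx2
      · rw [norm_neg]; exact h₄.trans_lt (by nlinarith)
    intro h0
    have hx3 : x ^ 2 = (W.a₁ * y - 2 * W.a₂ * x - W.a₄) * (3 : ℚ_[p])⁻¹ := by
      field_simp
      linear_combination (-1 : ℚ_[p]) * h0
    have : ‖x‖ ^ 2 = ‖W.a₁ * y - 2 * W.a₂ * x - W.a₄‖ := by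
      rw [← norm_pow, hx3, norm_mul, norm_inv, h3, inv_one, mul_one]
    rw [this] at hlt
    exact lt_irrefl _ hlt

/-! ### The inverse dictionary and `F(z(P), z(Q)) = z(P + Q)` without `IsElliptic` -/

/-- **The inverse dictionary for every integral equation** (AEC VII.2.2: "`𝓜 → E₁(K)`,
`z ↦ (z/w(z), -1/w(z))` … with inverse `(x, y) ↦ -x/y`"): every `z` of the open unit disc is the
parameter of a point of `E₁(ℚ_p)` (`z = 0` ↦ `O`; `z ≠ 0` ↦ the affine point `(z/w(z), -1/w(z))`,
nonsingular by `nonsingular_of_one_lt_norm_x`). [cite: SilvermanAEC2009, VII.2.2] -/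
theorem exists_isInReductionKernel_formalParameter_eq_of_isIntegral {z : ℚ_[p]} (hz : ‖z‖ < 1) :
    ∃ P : W.toAffine.Point, W.IsInReductionKernel P ∧ W.formalParameter P = z := by
  by_cases hz0 : z = 0
  · exact ⟨0, W.isInReductionKernel_zero, by rw [hz0]; rfl⟩
  have heq := W.equation_of_formalParameter hz hz0
  have hx := W.one_lt_norm_x_of_formalParameter hz hz0
  have hns : W.toAffine.Nonsingular (z / padicEval W.formalW z) (-1 / padicEval W.formalW z) :=
    W.nonsingular_of_one_lt_norm_x heq hx
  have hw0 : padicEval W.formalW z ≠ 0 := by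
    intro h
    have := W.norm_padicEval_formalW hz
    rw [h, norm_zero] at this
    exact hz0 (norm_eq_zero.mp (pow_eq_zero_iff (n := 3) (by norm_num) |>.mp this.symm))
  refine ⟨.some _ _ hns, (W.isInReductionKernel_some hns).mpr hx, ?_⟩
  rw [W.formalParameter_some hns]
  field_simp

/-- **`F(z(P), z(Q)) = z(P + Q)` on `E₁(ℚ_p)` for every `p`-integral equation** (AEC VII.2.2:
the map `(x, y) ↦ -x/y` is a homomorphism `E₁(K) → Ê(M)`), by the cases `P = O`, `Q = O`,
`P = -Q` and the generic case of `FormalGroupLawPadicProofs.lean` (none of which uses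
`IsElliptic`). [Silverman AEC IV.1 (pp. 116–118), VII.2.2] [cite: SilvermanAEC2009, VII.2.2] -/
theorem padicEval₂_formalGroupLaw_eq_formalParameter_add {P Q : W.toAffine.Point}
    (hP : W.IsInReductionKernel P) (hQ : W.IsInReductionKernel Q) :
    padicEval₂ W.formalGroupLaw (W.formalParameter P) (W.formalParameter Q) =
      W.formalParameter (P + Q) := by
  rcases P with _ | ⟨x₁, y₁, h₁⟩ <;> rcases Q with _ | ⟨x₂, y₂, h₂⟩
  · show padicEval₂ W.formalGroupLaw 0 0 = 0
    rw [padicEval₂_zero_zero, W.constantCoeff_formalGroupLaw]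
  · show padicEval₂ W.formalGroupLaw 0 (-x₂ / y₂) = -x₂ / y₂
    exact padicEval₂_formalGroupLaw_zero_left h₂ hQ
  · show padicEval₂ W.formalGroupLaw (-x₁ / y₁) 0 = -x₁ / y₁
    exact padicEval₂_formalGroupLaw_zero_right h₁ hP
  · show padicEval₂ W.formalGroupLaw (-x₁ / y₁) (-x₂ / y₂) = W.formalParameter (_ + _)
    by_cases hxy : x₁ = x₂ ∧ y₁ = W.toAffine.negY x₂ y₂
    · rw [Affine.Point.add_of_Y_eq hxy.1 hxy.2]
      exact padicEval₂_formalGroupLaw_of_Y_eq h₁ h₂ hP hQ hxy.1 hxy.2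
    · exact padicEval₂_formalGroupLaw_of_not_neg h₁ h₂ hP hQ hxy

/-! ### Associativity -/

/-- **Associativity at points**: `F(F(u,v),w) = F(u,F(v,w))` for `u, v, w` of norm `< 1`, for every
`p`-integral equation. [Silverman AEC IV.2 (associativity of `F` "from properties of the addition
law on `E`")] [folklore] -/
theorem padicEval₂_formalGroupLaw_assoc_of_isIntegral {u v w : ℚ_[p]} (hu : ‖u‖ < 1) (hv : ‖v‖ < 1)
    (hw : ‖w‖ < 1) :
    padicEval₂ W.formalGroupLaw (padicEval₂ W.formalGroupLaw u v) w =
      padicEval₂ W.formalGroupLaw u (padicEval₂ W.formalGroupLaw v w) := by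
  obtain ⟨P, hP, rfl⟩ := W.exists_isInReductionKernel_formalParameter_eq_of_isIntegral hu
  obtain ⟨Q, hQ, rfl⟩ := W.exists_isInReductionKernel_formalParameter_eq_of_isIntegral hv
  obtain ⟨R, hR, rfl⟩ := W.exists_isInReductionKernel_formalParameter_eq_of_isIntegral hw
  rw [W.padicEval₂_formalGroupLaw_eq_formalParameter_add hP hQ,
    W.padicEval₂_formalGroupLaw_eq_formalParameter_add hQ hR,
    W.padicEval₂_formalGroupLaw_eq_formalParameter_add (isInReductionKernel_add hP hQ) hR,
    W.padicEval₂_formalGroupLaw_eq_formalParameter_add hP (isInReductionKernel_add hQ hR), add_assoc]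

/-- **Associativity of the formal group law for every `p`-integral Weierstrass equation over
`ℚ_p`**: `F(F(z₁,z₂),z₃) = F(z₁,F(z₂,z₃))` in `ℚ_p⟦z₁, z₂, z₃⟧` — from associativity at points by
the identity theorem for integral power series (the proof of `formalGroupLaw_assoc`, with the
inverse dictionary for integral equations). [Silverman AEC IV.2.1 (b), IV.2.2.3]
[cite: SilvermanAEC2009, IV.2.2.3] -/
theorem formalGroupLaw_assoc_of_isIntegral :
    MvPowerSeries.subst ![MvPowerSeries.subst ![(MvPowerSeries.X 0 : MvPowerSeries (Fin 3) ℚ_[p]),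
        MvPowerSeries.X 1] W.formalGroupLaw, MvPowerSeries.X 2] W.formalGroupLaw =
      MvPowerSeries.subst ![(MvPowerSeries.X 0 : MvPowerSeries (Fin 3) ℚ_[p]),
        MvPowerSeries.subst ![(MvPowerSeries.X 1 : MvPowerSeries (Fin 3) ℚ_[p]), MvPowerSeries.X 2]
          W.formalGroupLaw] W.formalGroupLaw := by
  have hF := W.isPadicInt_formalGroupLaw
  have hX : ∀ i j : Fin 3, ∀ k, IsPadicInt ((![(MvPowerSeries.X i : MvPowerSeries (Fin 3) ℚ_[p]),
      MvPowerSeries.X j]) k) := fun i j k => by fin_cases k <;> exact IsPadicInt.X _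
  have hX0 : ∀ i j : Fin 3, ∀ k, MvPowerSeries.constantCoeff
      ((![(MvPowerSeries.X i : MvPowerSeries (Fin 3) ℚ_[p]), MvPowerSeries.X j]) k) = 0 :=
    fun i j k => by fin_cases k <;> exact MvPowerSeries.constantCoeff_X _
  have hin : ∀ i j : Fin 3, IsPadicInt (MvPowerSeries.subst
      ![(MvPowerSeries.X i : MvPowerSeries (Fin 3) ℚ_[p]), MvPowerSeries.X j] W.formalGroupLaw) :=
    fun i j => hF.subst (hX i j) (MvPowerSeries.hasSubst_of_constantCoeff_zero (hX0 i j))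
  set aL : Fin 2 → MvPowerSeries (Fin 3) ℚ_[p] := ![MvPowerSeries.subst
    ![(MvPowerSeries.X 0 : MvPowerSeries (Fin 3) ℚ_[p]), MvPowerSeries.X 1] W.formalGroupLaw,
    MvPowerSeries.X 2] with haL
  set aR : Fin 2 → MvPowerSeries (Fin 3) ℚ_[p] := ![(MvPowerSeries.X 0 : MvPowerSeries (Fin 3) ℚ_[p]),
    MvPowerSeries.subst ![(MvPowerSeries.X 1 : MvPowerSeries (Fin 3) ℚ_[p]), MvPowerSeries.X 2]
      W.formalGroupLaw] with haR
  have haLi : ∀ k, IsPadicInt (aL k) := fun k => by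
    fin_cases k
    · exact hin 0 1
    · exact IsPadicInt.X _
  have haRi : ∀ k, IsPadicInt (aR k) := fun k => by
    fin_cases k
    · exact IsPadicInt.X _
    · exact hin 1 2
  have haL0 : ∀ k, MvPowerSeries.constantCoeff (aL k) = 0 := fun k => by
    fin_cases k
    · exact W.constantCoeff_formalGroupLaw_subst_X_X 0 1
    · exact MvPowerSeries.constantCoeff_X _
  have haR0 : ∀ k, MvPowerSeries.constantCoeff (aR k) = 0 := fun k => by
    fin_cases k
    · exact MvPowerSeries.constantCoeff_X _
    · exact W.constantCoeff_formalGroupLaw_subst_X_X 1 2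
  refine eq_of_padicEvalMv_eq (hF.subst haLi (MvPowerSeries.hasSubst_of_constantCoeff_zero haL0))
    (hF.subst haRi (MvPowerSeries.hasSubst_of_constantCoeff_zero haR0)) fun pt hpt => ?_
  rw [padicEvalMv_subst hF haLi haL0 hpt, padicEvalMv_subst hF haRi haR0 hpt]
  have hvL : (fun k => padicEvalMv (aL k) pt) = ![padicEval₂ W.formalGroupLaw (pt 0) (pt 1), pt 2] := by
    funext k; fin_cases k
    · show padicEvalMv (MvPowerSeries.subst ![(MvPowerSeries.X 0 : MvPowerSeries (Fin 3) ℚ_[p]),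
        MvPowerSeries.X 1] W.formalGroupLaw) pt = padicEval₂ W.formalGroupLaw (pt 0) (pt 1)
      rw [padicEvalMv_subst hF (hX 0 1) (hX0 0 1) hpt, padicEval₂_eq_padicEvalMv]
      congr 1; funext k; fin_cases k <;> simp
    · show padicEvalMv (MvPowerSeries.X 2 : MvPowerSeries (Fin 3) ℚ_[p]) pt = pt 2
      exact padicEvalMv_X 2 pt
  have hvR : (fun k => padicEvalMv (aR k) pt) = ![pt 0, padicEval₂ W.formalGroupLaw (pt 1) (pt 2)] := by
    funext k; fin_cases k
    · show padicEvalMv (MvPowerSeries.X 0 : MvPowerSeries (Fin 3) ℚ_[p]) pt = pt 0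
      exact padicEvalMv_X 0 pt
    · show padicEvalMv (MvPowerSeries.subst ![(MvPowerSeries.X 1 : MvPowerSeries (Fin 3) ℚ_[p]),
        MvPowerSeries.X 2] W.formalGroupLaw) pt = padicEval₂ W.formalGroupLaw (pt 1) (pt 2)
      rw [padicEvalMv_subst hF (hX 1 2) (hX0 1 2) hpt, padicEval₂_eq_padicEvalMv]
      congr 1; funext k; fin_cases k <;> simp
  rw [hvL, hvR, ← padicEval₂_eq_padicEvalMv, ← padicEval₂_eq_padicEvalMv]
  exact W.padicEval₂_formalGroupLaw_assoc_of_isIntegral (hpt 0) (hpt 1) (hpt 2)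

end WeierstrassCurve
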